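import Literature.NumberTheory.EllipticCurves.Kato2004.DivisibilityInputsZetaLine
import HarnessLib

/-!
# Kato 2004 (Astérisque 295), the ZETA SIDE of §17.13 at the prime `(p)`: (17.13.1) exactness at
# `𝐇¹_loc(T(k))/𝐇¹_loc(T'(k))`, Prop. 17.11 (injectivity of `𝔏_η`), Thm. 12.6 with Ex. 13.3 (the
# integral zeta span inside genuine Euler-system classes), Thm. 12.5 (1) + 16.6 (2) + 17.5 read at
# `𝔭 = (p)` (the zeta line is not divisible by `p` once `μ(L_p(E)) = 0`), and the fine quotient
# (14.9.3) — the SUB-PACKAGE of `Kato2004.DivisibilityInputs` that a `μ`-transfer at `(p)` consumes;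
# ONE construction fact (`exists_zetaSideInputs`) IMPLIED by the tree's
# `exists_divisibilityInputs_fineQuotient_zeta` (F1) and by its restatement with the zeta line (F1′)

Topic `NumberTheory/EllipticCurves`, sub-directory `Kato2004` (namespace = path).  Cell `bsd-smallim`
(rung K6 of `BirchSwinnertonDyer`, class X9, route `SmallImageMuTransfer`, crux `MuTransfer` = item
19629), seat `bsd-line-k6-p2` (D-0154 KEY (146) row 9, 2026-08-28).  Statements first; no instance
beyond the structure's own bundled fields; no notation; nothing asserted.

## Why (honest framing)

The K6 crux `MuTransfer` («one `p`-adic unit coefficient of `L_p(f, α)` forces `μ(X(E/ℚ_∞)) = 0`,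
`E[p]` irreducible, `p ≥ 5` good ordinary») is kernel-checked modulo ONE published construction fact,
F1 = `Kato2004.exists_divisibilityInputs_fineQuotient_zeta` (Summits-side
`Theorems.smallImageMuTransfer_MuTransfer_of_fine`, p482919).  F1 is the WHOLE §17.13 package
`DivisibilityInputs` (30 fields: Thm. 12.4 (1), 12.5 (2)–(4), 12.6, 16.6 (2), 17.4 (2), Prop. 17.11,
(17.13.1)–(17.13.4), p. 280) with the fine quotient and the Thm. 12.6 span clause.  READING THE
CONSUMERS shows that the non-surjective branch of the crux (the cell's Theorem A,
`X10.mu_eq_zero_of_coreOddPrime`, through `Kato2004.exists_isEulerSystemClass_not_mem` and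
`Kato2004.lengthAt_X_le_lengthAt_fine`) touches only: `loc`, `toX`, `exact_P`, `col`, `col_injective`,
`Z`, the FIRST clause of `image_zeta_localized` AT `𝔭 = (p)` ONLY, the fine quotient `π` (surjective,
exact after `toX`) and the span clause.  It never touches `H2`, `H2loc`, `δ`, `ε`, `exact_X`,
`exact_H2`, `finite_H2`, `isTorsion_H2` (Thm. 12.4 (1)), `finite_H2loc` ((17.13.4)), `loc_injective`
((17.13.2)), `finite_coker_col`, `n`, `G`, `ιG_eq`, `pow_mem` (17.4 (2)), `es_bound` (Thm. 12.5 (3) =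
the Euler-system length bound), `integral` (Thm. 12.5 (4) under (12.5.2), = 17.4 (3)), nor the height-one
primes `𝔭 ≠ (p)`.  In print: what the `μ`-transfer at an irreducible NON-surjective image consumes
of Kato is the CONSTRUCTION of the zeta elements with their explicit reciprocity law and Coleman map
(§§2–8, Thm. 12.5 (1), Thm. 12.6, Ex. 13.3, Thm. 16.6 (2), 17.5, Prop. 17.11) plus Poitou–Tate
((17.13.1) with (17.13.3), (14.9.3)) — and NOT Kato's Euler-system DIVISIBILITY theorems (Thm. 12.4,
12.5 (2)–(4), 13.4, 17.4).  This file types exactly that sub-package, so that (i) the published input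
of the new (non-surjective) half of the crux is stated at its true size, (ii) F1 and F1′ both project
onto it by FORGETTING fields (theorems `DivisibilityInputs.toZetaSideInputs`,
`exists_zetaSideInputs_of_fineQuotient_zeta`, `exists_zetaSideInputs_of_zetaLine`), and (iii) the
surjective branch can be keyed separately to the verbatim Thm. 17.4 (the tree's `kato_divisibility`).
It is WEAKER than F1 and than F1′ (implied by each), hence weaker than print; never stronger.

## What is here

* `ZetaSideInputs W p f κ γ I D Y` — hypothesis structure on the PINNED triple
  (`I.H = 𝐇¹_Γ(T_pW)`, `D.X = X(E/ℚ_∞)`, `Y.X = X₀(E/ℚ_∞)`): an abstract `Λ`-module `P`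
  (`= 𝐇¹_loc(T(k))/𝐇¹_loc(T'(k))`, (17.13.3)) with `loc : 𝐇¹ → P`, `toX : P → X` exact at `P`
  ((17.13.1), `p ≠ 2`), the Coleman map `col : P → Λ` INJECTIVE (Prop. 17.11), the zeta submodule
  `Z ≤ 𝐇¹` (Thm. 12.6) inside the `Λ`-span of genuine Euler-system classes (Ex. 13.3, tree predicate
  `IsEulerSystemClass`), the fine quotient `π : X ↠ X₀` exact after `toX` ((14.9.3)/(17.13.1), Kim
  AJM 148 §1.2.4), and ONE clause at `(p)`: under `Irr(E[p])`, for `G₁ ∈ Λ` with `ι G₁ = L_p(E,T)`,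
  some `s ∉ (p)` has `s·G₁ ∈ col(loc Z)` — Thm. 12.5 (1) (`z_{γ₀}`), Thm. 12.6 (`T^m z_{γ₀} ∈ Z`),
  Thm. 16.6 (2) + 17.5 + Prop. 17.11 (`col(loc z_{γ₀}) = u·L_p`, `u ∈ Λˣ` the period-ratio unit,
  Greenberg–Vatsal §3) read at `𝔭 = (p)` with the witness `s = T^m` (the F1′ reading; = the first
  half of the `(p)`-instance of `DivisibilityInputs.image_zeta_localized`).  Field names and types of
  the shared fields are those of `DivisibilityInputs` VERBATIM.
* `exists_zetaSideInputs` — ONE construction fact: the structure is inhabited for every `E/ℚ` on a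
  globally minimal model, every odd good ordinary `p`, the cyclotomic `(κ, γ)` matching the variable,
  every newform `f` of `W`, every `I, D, Y` (same outer binders as F1, `Module.Free/Finite` instance
  binders of `T_pW` included).
* THEOREMS (pure algebra / projections, nothing asserted): `DivisibilityInputs.toZetaSideInputs`
  (forget 19 fields; the `(p)`-clause from `image_zeta_localized` at the height-one prime `(p)`),
  `exists_zetaSideInputs_of_fineQuotient_zeta` (F1 ⟹ this fact), `exists_zetaSideInputs_of_zetaLine`
  (F1′ ⟹ this fact), and over a package `K : ZetaSideInputs …`: `K.exists_mem_Z_notMem` /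
  `K.exists_isEulerSystemClass_notMem` (§6 (i) of the cell's `μ`-transfer: `μ(L_p) = 0 ⟹` a genuine
  Euler-system class outside `p𝐇¹`), `K.lengthAt_X_le_lengthAt_fine` (`length_(p) X ≤ length_(p) X₀`)
  and `K.mu_eq_zero_of_lengthAt_fine_eq_zero` (`length_(p) X₀ = 0 ⟹ D.mu = 0`).

## What is NOT here

Everything of `DivisibilityInputs` listed above as untouched; the surjective-image branch (Thm. 17.4 (3)
= the tree's `kato_divisibility`, file `PAdicBSD`); any proof of the fact (size: the construction of the
zeta elements, the explicit reciprocity law Thm. 16.6 and the Coleman map Prop. 17.11 are not in the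
tree; Poitou–Tate over `ℚ` is — `GaloisCohomology.poitouTate_sum_localTatePairing_eq_zero_holds` — but
not yet its `Λ`-adic limit (17.13.1)).  BSD is not advanced; the consumer's closes are conditional.

## References (K. Kato, Astérisque 295 (2004); `[p. N]` = printed page, PDF page `N − 115` of the held
text `paper:doi-10-24033-ast-639`)

* Thm. 12.5 (1) [p. 221]; Thm. 12.6 [p. 222]; Ex. 13.3 [p. 225]; (14.9.3) [p. 240]; Thm. 16.6 (2)
  [p. 271]; 17.5 [p. 274]; Prop. 17.11 [p. 277]; §17.13 (17.13.1), (17.13.3) [p. 279] and p. 280.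
  [Kato2004Asterisque]
* R. Greenberg, V. Vatsal, Invent. Math. 142 (2000), §3 Remark 3.4 and Prop. 3.7. [GreenbergVatsal2000]
* L. Washington, *Introduction to Cyclotomic Fields*, §13.2 (height-one primes of `Λ`). [Washington1997]
* Tree: `Kato2004/DivisibilityInputs.lean` (the full package, its module-docstring READING inherited
  here verbatim), `Kato2004/DivisibilityInputsFine.lean` (`lengthAt_X_le_lengthAt_fine`),
  `Kato2004/EulerSystemClasses.lean` (F1, `IsEulerSystemClass`, `exists_isEulerSystemClass_not_mem`),
  `Kato2004/DivisibilityInputsZetaLine.lean` (F1′); consumer `Summits/…/Rank1Residual/X10/CoreTheoremAOddPrime.lean`.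
-/

noncomputable section

open scoped MatrixGroups ModularForm
open Field CongruenceSubgroup
open Literature.NumberTheory.GaloisRepresentations
open Literature.NumberTheory.EllipticCurves Literature.NumberTheory.EllipticCurves.ModularForms
open Literature.NumberTheory.EllipticCurves.Kato2004.EulerSystemValues
open Literature.NumberTheory.EllipticCurves.IwasawaAlgebra

namespace Literature.NumberTheory.EllipticCurves.Kato2004

open Module

/-! ## The zeta-side package at `(p)` -/

section Package

variable (W : WeierstrassCurve ℚ) [W.IsElliptic] [W.IsGloballyMinimal] (p : ℕ) [Fact p.Prime]
  [ContinuousSMul ℤ_[p] (W.tateModule p)] [Module.Free ℤ_[p] (W.tateModule p)]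
  [Module.Finite ℤ_[p] (W.tateModule p)] {N : ℕ} [NeZero N] (f : CuspForm (Gamma0 N) 2)
  (κ : ZpExtension ℚ p) (γ : absoluteGaloisGroup ℚ)
  (I : IwasawaH1Data W p κ γ) (D : W.SelmerDualData κ γ) (Y : W.FineSelmerDualData κ γ)

/-- **Kato's §17.13 inputs ON THE ZETA SIDE AT `(p)` — hypothesis structure (nothing asserted).**  For
the pinned `I.H = 𝐇¹_Γ(T_pW)`, `D.X = X(E/ℚ_∞)`, `Y.X = X₀(E/ℚ_∞)` and a newform `f` of `W`: an
abstract `Λ`-module `P` (`= 𝐇¹_loc(T(k))/𝐇¹_loc(T'(k))`, (17.13.3)) with the maps `loc : 𝐇¹ → P`,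
`toX : P → X` of (17.13.1), exact at `P` (`p ≠ 2`); the Coleman map `col : P → Λ` of Prop. 17.11,
injective; the `Λ`-span `Z ≤ 𝐇¹` of the integral zeta elements (Thm. 12.6), contained in the span of
GENUINE `Λ`-adic Euler-system classes (Ex. 13.3 "`(z_m)_m` is an Euler system for `(T, F_λ, Σ)`";
tree `IsEulerSystemClass`); the fine quotient `π : X ↠ X₀`, exact after `toX` ((14.9.3) with
(17.13.1): `Coker(P → 𝔛) = X₀`); and, under `Irr(E[p])`, for `G₁ ∈ Λ` with `ι G₁ = L_p(E,T)`, a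
witness `s ∉ (p)` with `s·G₁ ∈ col(loc Z)` (Thm. 12.5 (1), Thm. 12.6 "`Z(f,T)/Z` is a finite group",
Thm. 16.6 (2) "`L_{p-adic,α,ω,γ}(f) = 𝔏_η(z_γ^{(p)}(f*)(k))`", 17.5, Prop. 17.11 and p. 280, read at
`𝔭 = (p)`: `s = T^m` through `T^m z_{γ₀} ∈ Z`, `col(loc z_{γ₀}) = u·G₁`).  The shared fields are those
of `Kato2004.DivisibilityInputs` VERBATIM; this is its sub-package consumed by a `μ`-argument at `(p)`.
[cite: Kato2004Asterisque, Thm. 12.5 (1) (p. 221), Thm. 12.6 (p. 222), Ex. 13.3 (p. 225), (14.9.3) (p. 240), Thm. 16.6 (2) (p. 271), 17.5 (p. 274), Prop. 17.11 (p. 277), §17.13 (17.13.1) and (17.13.3) (p. 279) and p. 280]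
[cite: GreenbergVatsal2000, §3 Remark 3.4 and Prop. 3.7] -/
structure ZetaSideInputs where
  /-- `P = 𝐇¹_loc(T(k))/𝐇¹_loc(T'(k))` ((17.13.3)), abstract. -/
  P : Type
  [addCommGroupP : AddCommGroup P]
  [moduleP : _root_.Module (IwasawaAlgebra p) P]
  /-- (17.13.1): `𝐇¹ → P` (localisation at `p` followed by the quotient by `𝐇¹_loc(T')`). -/
  loc : I.H →ₗ[IwasawaAlgebra p] P
  /-- (17.13.1): `P → 𝔛 = X(E/ℚ_∞)`. -/
  toX : P →ₗ[IwasawaAlgebra p] D.X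
  /-- (17.13.1) with (17.13.3), `p ≠ 2`: exactness at `P`. -/
  exact_P : Function.Exact loc toX
  /-- Prop. 17.11: the Coleman map `𝔏_η` induces `P → Λ` … -/
  col : P →ₗ[IwasawaAlgebra p] IwasawaAlgebra p
  /-- Prop. 17.11: … which is injective. -/
  col_injective : Function.Injective col
  /-- Thm. 12.6: the `Λ`-span `Z ⊂ 𝐇¹(T)` of the integral zeta elements (8.1.3)/(8.11), projected to
  the `Δ`-trivial component. -/
  Z : Submodule (IwasawaAlgebra p) I.H
  /-- Thm. 12.6 with Ex. 13.3: `Z` lies in the `Λ`-span of genuine `Λ`-adic Euler-system classes. -/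
  Z_le_span : Z ≤ Submodule.span (IwasawaAlgebra p) {s : I.H | IsEulerSystemClass W p κ γ I s}
  /-- (14.9.3)/(17.13.1): the fine quotient `X(E/ℚ_∞) → X₀(E/ℚ_∞)` (dual of `Sel₀ ⊆ Sel`) … -/
  π : D.X →ₗ[IwasawaAlgebra p] Y.X
  /-- … is surjective … -/
  π_surjective : Function.Surjective π
  /-- … and exact after `P → X` (`Coker(P → 𝔛) = X₀`). -/
  exact_toX_π : Function.Exact toX π
  /-- Thm. 12.5 (1), Thm. 12.6, Thm. 16.6 (2), 17.5, Prop. 17.11 and p. 280 read at `𝔭 = (p)`: under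
  `Irr(E[p])`, for `G₁ ∈ Λ` with `ι G₁ = L_p(E,T)`, some `s ∉ (p)` has `s·G₁ ∈ col(loc Z)` (witness
  `s = T^m` through `T^m z_{γ₀} ∈ Z`, `col(loc z_{γ₀}) = u·G₁`, `u ∈ Λˣ`). -/
  exists_notMem_smul_mem : W.HasIrreducibleModPGaloisRep p → ∀ G₁ : IwasawaAlgebra p,
    iwasawaToPowerSeries p G₁ = padicLFunction f (unitRoot W p : ℚ_[p]) →
      ∃ s : IwasawaAlgebra p, s ∉ augIdealP p ∧ s * G₁ ∈ Submodule.map (col ∘ₗ loc) Z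

attribute [instance] ZetaSideInputs.addCommGroupP ZetaSideInputs.moduleP

end Package

/-! ## The named fact: the zeta-side package exists (Kato's construction, §§8, 12, 16, 17 for `f_E`) -/

/-- **Kato 2004, Thm. 12.5 (1), Thm. 12.6 with Ex. 13.3, Thm. 16.6 (2), 17.5, Prop. 17.11, §17.13
(17.13.1)/(17.13.3) and (14.9.3) for `T ≅ T_pE(−1)`, `k = 2`: the zeta-side package EXISTS on the
pinned triple `(𝐇¹_Γ(T_pW), X(E/ℚ_∞), X₀(E/ℚ_∞))`.**  For every elliptic curve `E/ℚ` with globally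
minimal model `W` (structure facts of `T_pW` as instance binders), every ODD good ordinary prime `p`,
the cyclotomic `κ` with topological generator `γ` matching the cyclotomic variable, every newform `f`
of `W`, every `I`, `D`, `Y`, the structure `ZetaSideInputs W p f κ γ I D Y` is inhabited (by Kato's
`𝐇¹_loc(T(k))/𝐇¹_loc(T'(k))`, the Poitou–Tate maps, `𝔏_η`, the span of the integral zeta elements
and the dual of `Sel₀ ⊆ Sel` — `Δ`-trivial components; READING of `DivisibilityInputs.lean`).  A
CONSTRUCTION fact, WEAKER than the tree's `exists_divisibilityInputs_fineQuotient_zeta` (F1) and than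
`exists_divisibilityInputsZetaLine_fineQuotient_zeta` (F1′) — both imply it by forgetting fields
(`exists_zetaSideInputs_of_fineQuotient_zeta`, `exists_zetaSideInputs_of_zetaLine`) — hence weaker than
print; never stronger; nothing asserted; no `_holds` expected soon.
[cite: Kato2004Asterisque, Thm. 12.5 (1) (p. 221), Thm. 12.6 (p. 222), Ex. 13.3 (p. 225), (14.9.3) (p. 240), Thm. 16.6 (2) (p. 271), 17.5 (p. 274), Prop. 17.11 (p. 277), §17.13 (pp. 279–280)]
[cite: GreenbergVatsal2000, §3 Remark 3.4 and Prop. 3.7] -/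
def exists_zetaSideInputs : Prop :=
  ∀ (W : WeierstrassCurve ℚ) [W.IsElliptic] [W.IsGloballyMinimal] (p : ℕ) [Fact p.Prime]
    [ContinuousSMul ℤ_[p] (W.tateModule p)] [Module.Free ℤ_[p] (W.tateModule p)]
    [Module.Finite ℤ_[p] (W.tateModule p)] {N : ℕ} [NeZero N] (f : CuspForm (Gamma0 N) 2)
    (κ : ZpExtension ℚ p) (γ : absoluteGaloisGroup ℚ),
    p ≠ 2 → IsOrdinaryAt W p → κ.IsCyclotomic → κ.IsTopGenerator γ → IsCyclotomicVariable p γ →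
    IsNewformOf W f →
    ∀ (I : IwasawaH1Data W p κ γ) (D : W.SelmerDualData κ γ) (Y : W.FineSelmerDualData κ γ),
      Nonempty (ZetaSideInputs W p f κ γ I D Y)

/-! ## Theorems: the full package projects onto the zeta side; F1 ⟹ the fact; F1′ ⟹ the fact -/

section Projection

variable {W : WeierstrassCurve ℚ} [W.IsElliptic] [W.IsGloballyMinimal] {p : ℕ} [Fact p.Prime]
  [ContinuousSMul ℤ_[p] (W.tateModule p)] [Module.Free ℤ_[p] (W.tateModule p)]
  [Module.Finite ℤ_[p] (W.tateModule p)] {N : ℕ} [NeZero N] {f : CuspForm (Gamma0 N) 2}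
  {κ : ZpExtension ℚ p} {γ : absoluteGaloisGroup ℚ}
  {I : IwasawaH1Data W p κ γ} {D : W.SelmerDualData κ γ} {Y : W.FineSelmerDualData κ γ}

/-- **`DivisibilityInputs` ⟹ `ZetaSideInputs` (forget 19 fields).**  Given the full §17.13 package `K`,
a fine quotient `π` (surjective, exact after `K.toX`) and the Thm. 12.6 span clause, the zeta-side
package with the SAME `P, loc, toX, col, Z`; its `(p)`-clause is the first half of
`K.image_zeta_localized` at the height-one prime `(p)` (`isPrime_augIdealP_holds`,
`height_augIdealP_holds`). [cite: Kato2004Asterisque, §17.13 (pp. 279–280)] -/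
def DivisibilityInputs.toZetaSideInputs (K : DivisibilityInputs W p f κ γ I D)
    (π : D.X →ₗ[IwasawaAlgebra p] Y.X) (hπs : Function.Surjective π) (hπ : Function.Exact K.toX π)
    (hZ : K.Z ≤ Submodule.span (IwasawaAlgebra p) {s : I.H | IsEulerSystemClass W p κ γ I s}) :
    ZetaSideInputs W p f κ γ I D Y where
  P := K.P
  loc := K.loc
  toX := K.toX
  exact_P := K.exact_P
  col := K.col
  col_injective := K.col_injective
  Z := K.Z
  Z_le_span := hZ
  π := π
  π_surjective := hπs
  exact_toX_π := hπ
  exists_notMem_smul_mem := fun hirr G₁ hG₁ ↦ by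
    obtain ⟨s, hs, hsG, -⟩ := K.image_zeta_localized hirr G₁ hG₁
      ⟨augIdealP p, isPrime_augIdealP_holds p⟩ (by exact height_augIdealP_holds p)
    exact ⟨s, hs, hsG⟩

/-- **F1 ⟹ the zeta-side fact**: `exists_divisibilityInputs_fineQuotient_zeta` (file
`EulerSystemClasses`) implies `exists_zetaSideInputs`, by `DivisibilityInputs.toZetaSideInputs`.
[cite: Kato2004Asterisque, Thm. 12.6 (p. 222) and §17.13 (pp. 279–280)] -/
theorem exists_zetaSideInputs_of_fineQuotient_zeta (h : exists_divisibilityInputs_fineQuotient_zeta) :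
    exists_zetaSideInputs := by
  intro W _ _ p _ _ _ _ N _ f κ γ hp hord hκ hγ hγ' hf I D Y
  obtain ⟨K, π, hπs, hπ, hZ⟩ := h W p f κ γ hp hord hκ hγ hγ' hf I D Y
  exact ⟨K.toZetaSideInputs π hπs hπ hZ⟩

/-- **F1′ ⟹ the zeta-side fact**: the print-verbatim restatement
`exists_divisibilityInputsZetaLine_fineQuotient_zeta` (file `DivisibilityInputsZetaLine`) implies
`exists_zetaSideInputs` (through F1). [cite: Kato2004Asterisque, Thm. 12.6 (p. 222), Thm. 16.6 (2) (p. 271) and §17.13 (pp. 279–280)] -/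
theorem exists_zetaSideInputs_of_zetaLine (h : exists_divisibilityInputsZetaLine_fineQuotient_zeta) :
    exists_zetaSideInputs :=
  exists_zetaSideInputs_of_fineQuotient_zeta (exists_divisibilityInputs_fineQuotient_zeta_of_zetaLine h)

end Projection

/-! ## Theorems over a zeta-side package: §6 (i) of the `μ`-transfer and the bookkeeping at `(p)` -/

section Consequences

variable {W : WeierstrassCurve ℚ} [W.IsElliptic] [W.IsGloballyMinimal] {p : ℕ} [Fact p.Prime]
  [ContinuousSMul ℤ_[p] (W.tateModule p)] [Module.Free ℤ_[p] (W.tateModule p)]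
  [Module.Finite ℤ_[p] (W.tateModule p)] {N : ℕ} [NeZero N] {f : CuspForm (Gamma0 N) 2}
  {κ : ZpExtension ℚ p} {γ : absoluteGaloisGroup ℚ}
  {I : IwasawaH1Data W p κ γ} {D : W.SelmerDualData κ γ} {Y : W.FineSelmerDualData κ γ}

omit [NeZero N] in
/-- **§6 (i): `μ(L_p(E)) = 0 ⟹` the zeta submodule is not inside `p·𝐇¹`.**  If `E[p]` is irreducible,
`ι G₁ = L_p(E,T)` and `G₁ ∉ (p)`, then some `z ∈ K.Z` is not in `p·𝐇¹_Γ(T_pW)`: the `(p)`-clause gives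
`s ∉ (p)` with `s·G₁ ∈ col(loc Z)`; were `Z ⊆ p·𝐇¹`, then `col(loc Z) ⊆ pΛ ∋ s·G₁`, and `(p)` is prime.
(= `Kato2004.exists_mem_zeta_not_mem_of_mu_eq_zero` over the sub-package.)
[cite: Kato2004Asterisque, Thm. 12.6 (p. 222) and §17.13 (p. 280)] -/
theorem ZetaSideInputs.exists_mem_Z_notMem (K : ZetaSideInputs W p f κ γ I D Y)
    (hirr : W.HasIrreducibleModPGaloisRep p) {G₁ : IwasawaAlgebra p}
    (hG₁ : iwasawaToPowerSeries p G₁ = padicLFunction f (unitRoot W p : ℚ_[p]))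
    (hμ : G₁ ∉ augIdealP p) :
    ∃ z ∈ K.Z, z ∉ augIdealP p • (⊤ : Submodule (IwasawaAlgebra p) I.H) := by
  obtain ⟨s, hs, hsG⟩ := K.exists_notMem_smul_mem hirr G₁ hG₁
  by_contra hcon
  push Not at hcon
  have hZ : K.Z ≤ augIdealP p • (⊤ : Submodule (IwasawaAlgebra p) I.H) := fun z hz ↦ hcon z hz
  have hsub : Submodule.map (K.col ∘ₗ K.loc) K.Z ≤
      (augIdealP p • ⊤ : Submodule (IwasawaAlgebra p) (IwasawaAlgebra p)) :=
    (Submodule.map_mono hZ).trans (by rw [Submodule.map_smul'']; exact Submodule.smul_mono le_rfl le_top)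
  have htop : (augIdealP p • ⊤ : Submodule (IwasawaAlgebra p) (IwasawaAlgebra p)) = augIdealP p := by
    rw [Ideal.smul_eq_mul, Ideal.mul_top]
  have hsG' : s * G₁ ∈ augIdealP p := by rw [← htop]; exact hsub hsG
  rcases (isPrime_augIdealP_holds p).mem_or_mem hsG' with h | h
  · exact hs h
  · exact hμ h

omit [NeZero N] in
/-- **§6 (i) with Thm. 12.6 / Ex. 13.3: `μ(L_p(E)) = 0 ⟹` some GENUINE `Λ`-adic Euler-system class is
not divisible by `p` in `𝐇¹_Γ(T_pW)`** (the hypothesis of the cell's Theorem A core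
`X10.CoreTheoremAOddPrime`), from `exists_mem_Z_notMem` and the span clause `Z_le_span`
(`exists_mem_not_mem_of_le_span`). [cite: Kato2004Asterisque, Thm. 12.6 (p. 222), Ex. 13.3 (p. 225) and §17.13 (p. 280)] -/
theorem ZetaSideInputs.exists_isEulerSystemClass_notMem (K : ZetaSideInputs W p f κ γ I D Y)
    (hirr : W.HasIrreducibleModPGaloisRep p) {G₁ : IwasawaAlgebra p}
    (hG₁ : iwasawaToPowerSeries p G₁ = padicLFunction f (unitRoot W p : ℚ_[p]))
    (hμ : G₁ ∉ augIdealP p) :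
    ∃ s : I.H, IsEulerSystemClass W p κ γ I s ∧
      s ∉ augIdealP p • (⊤ : Submodule (IwasawaAlgebra p) I.H) := by
  obtain ⟨z, hz, hzp⟩ := K.exists_mem_Z_notMem hirr hG₁ hμ
  obtain ⟨s, hs, hsp⟩ := exists_mem_not_mem_of_le_span K.Z_le_span hz hzp
  exact ⟨s, hs, hsp⟩

omit [NeZero N] in
/-- **(14.9.3)/(17.13.1) bookkeeping at `𝔭 = (p)`, under `Irr(E[p])` and `μ(L_p(E)) = 0`:
`length_(p) X(E/ℚ_∞) ≤ length_(p) X₀(E/ℚ_∞)`.**  From the `(p)`-clause, `col(loc Z) ∋ s·G₁ ∉ (p)`, so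
`(Λ/col(loc Z))_(p) = 0`; `P/loc Z ↪ Λ/col(loc Z)` (`col` injective, Prop. 17.11); `P/loc Z → X → X₀`
is exact at `X` (`exact_P`, `exact_toX_π`); hence `length_(p) X ≤ 0 + length_(p) X₀`.  (= the
`(p)`-instance of `Kato2004.lengthAt_X_le_lengthAt_fine` over the sub-package.)
[cite: Kato2004Asterisque, (14.9.3) (p. 240), Prop. 17.11 (p. 277) and §17.13 (pp. 279–280)] -/
theorem ZetaSideInputs.lengthAt_X_le_lengthAt_fine (K : ZetaSideInputs W p f κ γ I D Y)
    (hirr : W.HasIrreducibleModPGaloisRep p) {G₁ : IwasawaAlgebra p}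
    (hG₁ : iwasawaToPowerSeries p G₁ = padicLFunction f (unitRoot W p : ℚ_[p]))
    (hμ : G₁ ∉ augIdealP p) (𝔭 : PrimeSpectrum (IwasawaAlgebra p)) (h𝔭 : 𝔭.asIdeal = augIdealP p) :
    lengthAt (IwasawaAlgebra p) D.X 𝔭 ≤ lengthAt (IwasawaAlgebra p) Y.X 𝔭 := by
  obtain ⟨s, hs, hsG⟩ := K.exists_notMem_smul_mem hirr G₁ hG₁
  set LZ : Submodule (IwasawaAlgebra p) K.P := Submodule.map K.loc K.Z with hLZ
  set M : Ideal (IwasawaAlgebra p) := Submodule.map K.col LZ with hM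
  have hM_eq : Submodule.map (K.col ∘ₗ K.loc) K.Z = M := by
    rw [hM, hLZ, Submodule.map_comp]
  have hsGM : s * G₁ ∈ M := hM_eq ▸ hsG
  have hnot : ¬ M ≤ 𝔭.asIdeal := fun hle ↦ by
    rcases 𝔭.isPrime.mem_or_mem (hle hsGM) with h | h
    · exact hs (h𝔭 ▸ h)
    · exact hμ (h𝔭 ▸ h)
  have hΛM : lengthAt (IwasawaAlgebra p) (IwasawaAlgebra p ⧸ M) 𝔭 = 0 :=
    lengthAt_quotient_eq_zero_of_not_le hnot
  have hPLZ : lengthAt (IwasawaAlgebra p) (K.P ⧸ LZ) 𝔭 = 0 := by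
    refine le_antisymm ?_ bot_le
    rw [← hΛM]
    refine lengthAt_le_of_injective (Submodule.mapQ LZ M K.col fun y hy ↦ ⟨y, hy, rfl⟩) ?_ 𝔭
    rw [← LinearMap.ker_eq_bot, Submodule.ker_mapQ, hM,
      Submodule.comap_map_eq_of_injective K.col_injective, Submodule.mkQ_map_self]
  have hle : LZ ≤ LinearMap.ker K.toX := by
    rintro _ ⟨z, -, rfl⟩
    exact (K.exact_P (K.loc z)).mpr ⟨z, rfl⟩
  let f' : (K.P ⧸ LZ) →ₗ[IwasawaAlgebra p] D.X := LZ.liftQ K.toX hle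
  have hf' : Function.Exact f' K.π := by
    rw [LinearMap.exact_iff, Submodule.range_liftQ]
    exact LinearMap.exact_iff.mp K.exact_toX_π
  calc lengthAt (IwasawaAlgebra p) D.X 𝔭
      ≤ lengthAt (IwasawaAlgebra p) (K.P ⧸ LZ) 𝔭 + lengthAt (IwasawaAlgebra p) Y.X 𝔭 :=
        lengthAt_le_add_of_exact f' K.π hf' 𝔭
    _ = lengthAt (IwasawaAlgebra p) Y.X 𝔭 := by rw [hPLZ, zero_add]

omit [NeZero N] in
/-- **`length_(p) X₀(E/ℚ_∞) = 0 ⟹ μ(X(E/ℚ_∞)) = 0`** under `Irr(E[p])` and one `p`-adic unit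
coefficient of `L_p(f, α)` (Greenberg–Vatsal Prop. 3.7 integrality `ι G₁ = L_p`; the certificate makes
`G₁ ∉ (p)`, `not_mem_augIdealP_of_norm_coeff_eq_one`): `length_(p) X ≤ length_(p) X₀ = 0` and
`μ = length_(p)` (`muInvariant_eq_toNat_lengthAt`).  The closer by which a Kolyvagin-type finiteness of
`Sel₀(ℚ_∞, E[p^∞])[p]` becomes `D.mu = 0`. [cite: Kato2004Asterisque, (14.9.3) (p. 240) and §17.13 (p. 280)]
[cite: GreenbergVatsal2000, Prop. 3.7] -/
theorem ZetaSideInputs.mu_eq_zero_of_lengthAt_fine_eq_zero (K : ZetaSideInputs W p f κ γ I D Y)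
    (hirr : W.HasIrreducibleModPGaloisRep p) {G₁ : IwasawaAlgebra p}
    (hG₁ : iwasawaToPowerSeries p G₁ = padicLFunction f (unitRoot W p : ℚ_[p]))
    (hcert : ∃ n : ℕ, ‖PowerSeries.coeff n (padicLFunction f (unitRoot W p : ℚ_[p]))‖ = 1)
    (𝔭 : PrimeSpectrum (IwasawaAlgebra p)) (h𝔭 : 𝔭.asIdeal = augIdealP p)
    (hY : lengthAt (IwasawaAlgebra p) Y.X 𝔭 = 0) : D.mu = 0 := by
  have hμ : G₁ ∉ augIdealP p := not_mem_augIdealP_of_norm_coeff_eq_one hG₁ hcert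
  have hX : lengthAt (IwasawaAlgebra p) D.X 𝔭 = 0 :=
    le_antisymm ((K.lengthAt_X_le_lengthAt_fine hirr hG₁ hμ 𝔭 h𝔭).trans hY.le) bot_le
  change muInvariant p D.X = 0
  rw [muInvariant_eq_toNat_lengthAt p D.X 𝔭 h𝔭, hX]
  rfl

end Consequences

end Literature.NumberTheory.EllipticCurves.Kato2004

end
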